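import Summits.AnomalousDissipation.AnomalousDissipation.Theorems.DenseLoudDesignerForces.Negative.DopplerCeiling

/-!
# Negative knowledge for the crux `DenseLoudDesignerForces` (stmt-AnomalousDissipation-1143), VII b:
# the Doppler ceiling under a UNIFORMLY SWEPT stock (drift class of the line `galilean-detuning-body-force-grid`)

If every non-zero stock mode is swept at rate `|k·V| ≥ ω₀‖k‖` (for the line's good drifts `V = √E_V n̂`,
`|k̂·n̂| ≥ κ`, this is `ω₀ = κ√E_V`), the strain of the Doppler antiderivative obeys `Λ(c') ≤ (√3/ω₀) ∑_k ‖c_k‖`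
(`gradBound_dopplerCoeff_le`), so the Doppler ceiling of `Negative/DopplerCeiling` becomes the SWEEPING CEILING
`⟨ν‖∇u‖²⟩ ≤ (√3/ω₀)(∑_k‖c_k‖)·⟨‖u-V‖²⟩ + (ν/2)(⟨‖u-V‖²⟩ + Λ₂(c')²)` (`meanDissipation_le_swept`): in the drift class
(`⟨‖u-V‖²⟩ = E_w`) loudness `ε` needs an in-phase FLUCTUATION stress `E_w ≳ ε κ√E_V/(√3‖c‖₁)`; the sweep itself
injects nothing (refuter, drefute seat; certified N1 of `Cruxes/DenseLoudDesignerForces/NegativeNotesGridLoudness.md`).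
Supports stmt-AnomalousDissipation-1143.
-/

noncomputable section

namespace Summit.AnomalousDissipation.AnomalousDissipation.Theorems.DenseLoudDesignerForces.Negative

open scoped BigOperators Topology ENNReal InnerProductSpace
open Filter Set MeasureTheory UnitAddTorus
open Literature.Analysis.FunctionSpaces Literature.Analysis.FluidPDE
open Summit.AnomalousDissipation.AnomalousDissipation.Theses.BaireTransfer

section Swept

variable {S : Finset (Fin 3 → ℤ)} {V : EuclideanSpace ℝ (Fin 3)} {ω₀ : ℝ}

/-- `∑ᵢ |kᵢ| ≤ √3 ‖k‖` for a lattice vector in dimension three (Cauchy–Schwarz). -/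
theorem sum_abs_le_sqrt_three_mul_norm (k : Fin 3 → ℤ) :
    ∑ i : Fin 3, |((k i : ℤ) : ℝ)| ≤ Real.sqrt 3 * ‖Torus.latticeVec k‖ := by
  have hn : ‖Torus.latticeVec k‖ = Real.sqrt (∑ i : Fin 3, ((k i : ℤ) : ℝ) ^ 2) := by
    rw [EuclideanSpace.norm_eq]
    congr 1
    refine Finset.sum_congr rfl fun i _ => ?_
    rw [Torus.latticeVec_apply, Real.norm_eq_abs, sq_abs]
  rw [hn, ← Real.sqrt_mul (by norm_num : (0 : ℝ) ≤ 3)]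
  refine (Real.le_sqrt (Finset.sum_nonneg fun i _ => abs_nonneg _) (by positivity)).2 ?_
  simp only [Fin.sum_univ_three]
  have h0 := sq_abs (((k 0 : ℤ) : ℝ))
  have h1 := sq_abs (((k 1 : ℤ) : ℝ))
  have h2 := sq_abs (((k 2 : ℤ) : ℝ))
  nlinarith [sq_nonneg (|((k 0 : ℤ) : ℝ)| - |((k 1 : ℤ) : ℝ)|), sq_nonneg (|((k 1 : ℤ) : ℝ)| - |((k 2 : ℤ) : ℝ)|),
    sq_nonneg (|((k 0 : ℤ) : ℝ)| - |((k 2 : ℤ) : ℝ)|)]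

/-- A non-zero lattice vector has positive norm. -/
theorem norm_latticeVec_pos_of_ne_zero {k : Fin 3 → ℤ} (hk : k ≠ 0) : 0 < ‖Torus.latticeVec k‖ := by
  refine norm_pos_iff.2 fun h => hk ?_
  funext i
  have hi := congrArg (fun v : EuclideanSpace ℝ (Fin 3) => v i) h
  simp only [Torus.latticeVec_apply, PiLp.zero_apply] at hi
  exact_mod_cast hi

/-- Norm of a Doppler coefficient: `‖c'_k‖ = ‖c_k‖/(2π|k·V|)` off the resonant planes. -/
theorem norm_dopplerCoeff (c : ↥S → (EuclideanSpace ℂ (Fin 3))) (k : ↥S) :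
    ‖dopplerCoeff S V c k‖ = ‖c k‖ / (2 * Real.pi * |dopplerFreq V (k : Fin 3 → ℤ)|) := by
  show ‖(2 * Real.pi * Complex.I * (dopplerFreq V (k : Fin 3 → ℤ) : ℂ))⁻¹ • c k‖ = _
  rw [norm_smul, norm_inv]
  simp only [norm_mul, Complex.norm_I, Complex.norm_real, Real.norm_eq_abs, Complex.norm_ofNat, mul_one,
    abs_of_pos Real.pi_pos]
  rw [div_eq_inv_mul]

/-- STRAIN OF THE DOPPLER ANTIDERIVATIVE UNDER UNIFORM SWEEPING: if `ω₀‖k‖ ≤ |k·V|` for every `k ∈ S ∖ {0}`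
(`ω₀ > 0`) then `Λ(c') ≤ (√3/ω₀) ∑_k ‖c_k‖`. -/
theorem gradBound_dopplerCoeff_le (hω₀ : 0 < ω₀)
    (hω : ∀ k ∈ S, k ≠ 0 → ω₀ * ‖Torus.latticeVec k‖ ≤ |dopplerFreq V k|) (c : ↥S → (EuclideanSpace ℂ (Fin 3))) :
    gradBound S (dopplerCoeff S V c) ≤ Real.sqrt 3 / ω₀ * ∑ k : ↥S, ‖c k‖ := by
  unfold gradBound
  rw [Finset.sum_comm, Finset.mul_sum]
  refine Finset.sum_le_sum fun k _ => ?_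
  by_cases hk0 : (k : Fin 3 → ℤ) = 0
  · have h0 : ∀ i : Fin 3, |((((k : Fin 3 → ℤ) i : ℤ) : ℝ))| = 0 := fun i => by rw [hk0]; simp
    simp only [h0, mul_zero, zero_mul, Finset.sum_const_zero]
    positivity
  · have hkpos : 0 < ‖Torus.latticeVec (k : Fin 3 → ℤ)‖ := norm_latticeVec_pos_of_ne_zero hk0
    have hσ : ω₀ * ‖Torus.latticeVec (k : Fin 3 → ℤ)‖ ≤ |dopplerFreq V k| := hω k k.2 hk0
    have hσpos : 0 < |dopplerFreq V (k : Fin 3 → ℤ)| := lt_of_lt_of_le (mul_pos hω₀ hkpos) hσ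
    have hsum := sum_abs_le_sqrt_three_mul_norm (k : Fin 3 → ℤ)
    have hc : 0 ≤ ‖c k‖ := norm_nonneg _
    simp_rw [norm_dopplerCoeff c k]
    rw [← Finset.sum_mul, ← Finset.mul_sum]
    set s : ℝ := ∑ i : Fin 3, |((((k : Fin 3 → ℤ) i : ℤ) : ℝ))| with hs
    have hs0 : 0 ≤ s := Finset.sum_nonneg fun i _ => abs_nonneg _
    have hkey : s / |dopplerFreq V (k : Fin 3 → ℤ)| ≤ Real.sqrt 3 / ω₀ :=
      calc s / |dopplerFreq V (k : Fin 3 → ℤ)| ≤ Real.sqrt 3 * ‖Torus.latticeVec (k : Fin 3 → ℤ)‖ /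
            |dopplerFreq V (k : Fin 3 → ℤ)| := by gcongr
        _ ≤ Real.sqrt 3 * ‖Torus.latticeVec (k : Fin 3 → ℤ)‖ / (ω₀ * ‖Torus.latticeVec (k : Fin 3 → ℤ)‖) := by
            gcongr
        _ = Real.sqrt 3 / ω₀ := mul_div_mul_right _ _ hkpos.ne'
    calc 2 * Real.pi * s * (‖c k‖ / (2 * Real.pi * |dopplerFreq V (k : Fin 3 → ℤ)|))
        = s / |dopplerFreq V (k : Fin 3 → ℤ)| * ‖c k‖ := by
          field_simp
      _ ≤ Real.sqrt 3 / ω₀ * ‖c k‖ := mul_le_mul_of_nonneg_right hkey hc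

variable {ν τ : ℝ} {c : ↥S → (EuclideanSpace ℂ (Fin 3))}
  {u : ℝ → (UnitAddTorus (Fin 3)) → (EuclideanSpace ℝ (Fin 3))} {p : ℝ → (UnitAddTorus (Fin 3)) → ℝ}

/-- SWEEPING CEILING.  For every `τ`-periodic classical orbit forced by `f_c` (`ν ≥ 0`, `τ > 0`) and every constant
`V` sweeping the stock uniformly (`ω₀‖k‖ ≤ |k·V|` on `S ∖ {0}`, `ω₀ > 0`):
`⟨ν‖∇u‖²⟩ ≤ (√3/ω₀)(∑_k ‖c_k‖)·⟨‖u-V‖²⟩ + (ν/2)(⟨‖u-V‖²⟩ + Λ₂(c')²)`.  In the drift class of the line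
(`V = √E_V n̂`, `ω₀ = κ√E_V`, `⟨‖u-V‖²⟩ = E_w`): `ε κ √E_V ≤ √3 ‖c‖₁ E_w + O(ν)`. -/
theorem meanDissipation_le_swept (hω₀ : 0 < ω₀)
    (hω : ∀ k ∈ S, k ≠ 0 → ω₀ * ‖Torus.latticeVec k‖ ≤ |dopplerFreq V k|)
    (h : Torus.IsClassicalNSSolutionOn univ ν (fun _ => force S c) u p) (hν : 0 ≤ ν)
    (hper : Function.Periodic u τ) (hτ : 0 < τ) :
    meanDissipation ν u ≤ Real.sqrt 3 / ω₀ * (∑ k : ↥S, ‖c k‖) * meanEnergy (fun t x => u t x - V) +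
      ν / 2 * (meanEnergy (fun t x => u t x - V) + lapBound S (dopplerCoeff S V c) ^ 2) := by
  have hV : ∀ k ∈ S, k ≠ 0 → dopplerFreq V k ≠ 0 := fun k hk hk0 => by
    have := lt_of_lt_of_le (mul_pos hω₀ (norm_latticeVec_pos_of_ne_zero hk0)) (hω k hk hk0)
    exact abs_pos.1 this
  have h1 := meanDissipation_le_doppler_force hV h hν hper hτ
  have hwper : Function.Periodic (fun t x => u t x - V) τ := fun t => by simp only [hper t]
  have hE : 0 ≤ meanEnergy (fun t x => u t x - V) := meanEnergy_nonneg' hwper hτ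
  have h2 := mul_le_mul_of_nonneg_right (gradBound_dopplerCoeff_le hω₀ hω c) hE
  linarith

end Swept

end Summit.AnomalousDissipation.AnomalousDissipation.Theorems.DenseLoudDesignerForces.Negative

end
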